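import Literature.NumberTheory.Transcendental.KaehlerIdentityLocalityProofs
import HarnessLib

/-!
# Locality of `∂̄` and of the `∂̄`-Laplacian (Warner 6.33: "`φ L(τα) = φ Lα`")

F. W. Warner, GTM 94 (1983), 6.33 uses that a differential operator is local: for a cut-off `τ`
equal to `1` near the support of `φ`, `φ · Δ(τ α) = φ · Δ α`. We record the locality of `∂̄`
(`dolbeaultBar_congr_of_eventuallyEq`, companion of the tree's `dolbeault_congr_of_eventuallyEq`
and `dolbeaultBarAdjoint_congr_of_eventuallyEq`), of `Δ_∂̄` in all degrees
(`dolbeaultLaplacian_congr_of_eventuallyEq`), and the cut-off form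
`fun_smul_dolbeaultLaplacian_fun_smul` used in the compactness argument.

## References

* F. W. Warner, GTM 94 (1983), 6.33. [WarnerGTM94]
* C. Voisin, *Hodge Theory and Complex Algebraic Geometry I* (2002), §2.3.3, §5.1.2. [VoisinHodgeI2002]
-/

noncomputable section

open scoped Manifold ContDiff Topology
open Set Finset Function Complex Bundle Module Filter
open Literature.Geometry.Kaehler

namespace Literature.NumberTheory.Transcendental

section Locality

variable {E : Type*} [NormedAddCommGroup E] [NormedSpace ℂ E]
  {M : Type*} [TopologicalSpace M] [ChartedSpace E M] {k m : ℕ}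

/-- **Locality of `∂̄`**: forms agreeing near `z` have the same `∂̄` at `z`. [cite: VoisinHodgeI2002, §2.3.3] -/
theorem dolbeaultBar_congr_of_eventuallyEq {α β : MForm 𝓘(ℝ, E) M ℂ k} {z : M}
    (h : ∀ᶠ w in 𝓝 z, α w = β w) : dolbeaultBar α z = dolbeaultBar β z := by
  have hpq : ∀ p q, mextDeriv (α.typeComponent p q) z = mextDeriv (β.typeComponent p q) z :=
    fun p q ↦ mextDeriv_congr_of_eventuallyEq (typeComponent_eventuallyEq p q h)
  simp only [dolbeaultBar, Finset.sum_apply]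
  refine Finset.sum_congr rfl fun pq _ ↦ ?_
  rw [typeComponent_apply_eq_typeProjAt, typeComponent_apply_eq_typeProjAt, hpq]

/-- Locality of `∂̄`, germ form. [folklore] -/
theorem dolbeaultBar_eventuallyEq_of_eventuallyEq {α β : MForm 𝓘(ℝ, E) M ℂ k} {z : M}
    (h : ∀ᶠ w in 𝓝 z, α w = β w) : ∀ᶠ w in 𝓝 z, dolbeaultBar α w = dolbeaultBar β w := by
  filter_upwards [h.eventually_nhds] with w hw
  exact dolbeaultBar_congr_of_eventuallyEq hw

variable [FiniteDimensional ℂ E] {n : ℕ} [Fact (finrank ℝ E = n)]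
  [RiemannianBundle (fun x : M ↦ TangentSpace 𝓘(ℝ, E) x)]
  (o : (x : M) → Orientation ℝ (TangentSpace 𝓘(ℝ, E) x) (Fin n))

/-- **Locality of `Δ_∂̄`** (all degrees): forms agreeing near `z` have the same `Δ_∂̄` at `z`.
[cite: VoisinHodgeI2002, §5.1.2] -/
theorem dolbeaultLaplacian_congr_of_eventuallyEq :
    ∀ (k m : ℕ) (h : k + m = n) {α β : MForm 𝓘(ℝ, E) M ℂ k} {z : M}, (∀ᶠ w in 𝓝 z, α w = β w) →
      dolbeaultLaplacian o k m h α z = dolbeaultLaplacian o k m h β z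
  | 0, 0, _, _, _, _, _ => rfl
  | 0, m + 1, _, α, β, z, hαβ => by
      simp only [dolbeaultLaplacian]
      exact dolbeaultBarAdjoint_congr_of_eventuallyEq o _ (dolbeaultBar_eventuallyEq_of_eventuallyEq hαβ)
  | k + 1, 0, _, α, β, z, hαβ => by
      simp only [dolbeaultLaplacian]
      exact dolbeaultBar_congr_of_eventuallyEq (dolbeaultBarAdjoint_eventuallyEq o _ hαβ)
  | k + 1, m + 1, h, α, β, z, hαβ => by
      simp only [dolbeaultLaplacian, Pi.add_apply]
      rw [dolbeaultBar_congr_of_eventuallyEq (dolbeaultBarAdjoint_eventuallyEq o h hαβ),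
        dolbeaultBarAdjoint_congr_of_eventuallyEq o _ (dolbeaultBar_eventuallyEq_of_eventuallyEq hαβ)]

/-- **`φ Δ(τ α) = φ Δ α` for a cut-off `τ` equal to `1` near the support of `φ`** (Warner 6.33).
[cite: WarnerGTM94, 6.33] -/
theorem fun_smul_dolbeaultLaplacian_fun_smul (h : k + m = n) {φ τ : M → ℝ}
    (hτφ : ∀ x, φ x ≠ 0 → ∀ᶠ w in 𝓝 x, τ w = 1) (α : MForm 𝓘(ℝ, E) M ℂ k) :
    φ • dolbeaultLaplacian o k m h (τ • α) = φ • dolbeaultLaplacian o k m h α := by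
  funext x
  simp only [Pi.smul_apply']
  by_cases hx : φ x = 0
  · rw [hx, zero_smul, zero_smul]
  · rw [dolbeaultLaplacian_congr_of_eventuallyEq o k m h (β := α)]
    filter_upwards [hτφ x hx] with w hw
    rw [Pi.smul_apply', hw, one_smul]

end Locality

end Literature.NumberTheory.Transcendental
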